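import Summits.Ventures.HodgeRepro2.T5SU11JacobiPhaseMGF

/-!
# All moments of the squared orbit radius: the Hausdorff–Bernstein–Widder differences at step `2`

Under `m_k φ_λ dν` the squared orbit radius `|g·0|² = 1 − m_2(g)` has the moments

  **`∫_G |g·0|^{2n} m_k φ_λ dν = (−1)^n Δ_2^n m̂_·(λ)(k) = ∑_{j ≤ n} (−1)^j C(n, j) m̂_{k+2j}(λ)`**

(`integral_orbit_pow_mul_eq_fwdDiff`, `integral_orbit_pow_mul_eq_sum`): the finite differences of
`T5SU11JacobiCompleteMonotone` at step `h = 2` are exactly the moments of the orbit radius, since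
`(1 − m_2)^n = |g·0|^{2n}`. In closed form, with the weight ratios `r_k(λ)` of
`T5SU11JacobiWeightRecursion`, `m̂_{k+2j} = m̂_k ∏_{i<j} r_{k+2i}`, so the normalised moments are

  **`E_{k,λ}[|g·0|^{2n}] = ∑_{j ≤ n} (−1)^j C(n, j) ∏_{i<j} r_{k+2i}(λ)`**   (`moment_orbit_sq_eq_sum_prod`),

rational functions of `k` and `λ` (`n = 1` is `T5SU11JacobiPhaseMGF.mean_orbit_sq_eq`). Every moment is
positive (`moment_orbit_sq_pos`), and `k^n E_{k,λ}[|g·0|^{2n}] → 2^n n!` — the rescaled orbit radius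
`k|g·0|²/2` has asymptotically the moments of `Exp(1)` — follows from the phase asymptotics but is left
to a successor. Nothing is claimed about (N).

Blind lane: Mathlib + the HodgeRepro2 prefix only; no sorry; axioms ⊆ {propext, Classical.choice,
Quot.sound}.
-/

namespace Summit.Ventures.HodgeRepro2.T5SU11JacobiOrbitMoments

open MeasureTheory MeasureTheory.Measure Metric Set Filter Topology Finset
open T5SU11Unimodular T5SU11Fibration T5SU11Cartan T5HaarCircle T5BergmanCoefficient
  T5SU11FibrationHaar T5SU11SphericalFunction T5SU11SphericalSymmetry T5SU11SphericalBounds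
  T5SU11SphericalContinuous T5SU11JacobiIwasawa T5SU11JacobiTransform T5SU11JacobiWeight
  T5SU11KFiniteMajorantPow T5SU11JacobiDuplication T5SU11JacobiWeightRecursion
  T5SU11JacobiCompleteMonotone T5SU11JacobiPhaseMGF
open scoped Real

/-- `(1 − m_2(g))^n = |g·0|^{2n}`. -/
theorem one_sub_orbit_rpow_two_pow (n : ℕ) (g : SU11) :
    (1 - (1 - ‖orbit g‖ ^ 2) ^ ((2 : ℝ) / 2)) ^ n = (‖orbit g‖ ^ 2) ^ n := by
  rw [show (2 : ℝ) / 2 = 1 by norm_num, Real.rpow_one, sub_sub_cancel]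

section measure

variable [MeasurableSpace Circle] [BorelSpace Circle]

/-- **The moments of the orbit radius are the HBW differences at step `2`**: on the ray,
`∫_G |g·0|^{2n} m_k φ_λ dν = (−1)^n Δ_2^n m̂_·(λ)(k)`. -/
theorem integral_orbit_pow_mul_eq_fwdDiff {k lam : ℝ} (hk : 1 < k) (h1 : lam < k) (h2 : 2 < k + lam)
    (n : ℕ) :
    ∫ g, (‖orbit g‖ ^ 2) ^ n * ((1 - ‖orbit g‖ ^ 2) ^ (k / 2) * sph lam g) ∂(nu haarCircle)
      = (-1 : ℝ) ^ n * ((fwdDiff (2 : ℝ))^[n] (fun k => ∫ g, (1 - ‖orbit g‖ ^ 2) ^ (k / 2) * sph lam g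
          ∂(nu haarCircle)) k) := by
  rw [jacobi_fwdDiff_iter_eq hk h1 h2 (by norm_num) n]
  refine integral_congr_ae (Filter.Eventually.of_forall fun g => ?_)
  simp only
  rw [one_sub_orbit_rpow_two_pow]
  ring

/-- The binomial form: `∫_G |g·0|^{2n} m_k φ_λ dν = ∑_{j ≤ n} (−1)^j C(n, j) m̂_{k+2j}(λ)`. -/
theorem integral_orbit_pow_mul_eq_sum {k lam : ℝ} (hk : 1 < k) (h1 : lam < k) (h2 : 2 < k + lam)
    (n : ℕ) :
    ∫ g, (‖orbit g‖ ^ 2) ^ n * ((1 - ‖orbit g‖ ^ 2) ^ (k / 2) * sph lam g) ∂(nu haarCircle)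
      = ∑ j ∈ range (n + 1), (-1 : ℝ) ^ j * (n.choose j : ℝ)
          * ∫ g, (1 - ‖orbit g‖ ^ 2) ^ ((k + 2 * j) / 2) * sph lam g ∂(nu haarCircle) := by
  have hi : ∀ j ∈ range (n + 1), Integrable (fun g => (-1 : ℝ) ^ j * (n.choose j : ℝ)
      * ((1 - ‖orbit g‖ ^ 2) ^ ((k + j * (2 : ℝ)) / 2) * sph lam g)) (nu haarCircle) := fun j _ => by
    have hj : (0 : ℝ) ≤ (j : ℝ) * 2 := by positivity
    exact (integrable_orbit_rpow_mul_sph (by linarith) (by linarith) (by linarith)).const_mul _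
  have e : ∀ g : SU11, (‖orbit g‖ ^ 2) ^ n * ((1 - ‖orbit g‖ ^ 2) ^ (k / 2) * sph lam g)
      = ∑ j ∈ range (n + 1), (-1 : ℝ) ^ j * (n.choose j : ℝ)
          * ((1 - ‖orbit g‖ ^ 2) ^ ((k + j * (2 : ℝ)) / 2) * sph lam g) := fun g => by
    rw [sum_orbit_rpow_shift_eq k 2 lam n g, one_sub_orbit_rpow_two_pow]
    ring
  rw [integral_congr_ae (Filter.Eventually.of_forall e), integral_finsetSum _ hi]
  refine Finset.sum_congr rfl fun j _ => ?_
  rw [integral_const_mul, show k + (j : ℝ) * 2 = k + 2 * j by ring]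

/-- `m̂_{k+2j}(λ) = (∏_{i<j} r_{k+2i}(λ)) · m̂_k(λ)` (the product formula of `T5SU11JacobiWeightRecursion`). -/
theorem jacobi_add_two_mul_eq_prod {k lam : ℝ} (hk : 1 < k) (h1 : lam < k) (h2 : 2 < k + lam) (j : ℕ) :
    ∫ g, (1 - ‖orbit g‖ ^ 2) ^ ((k + 2 * j) / 2) * sph lam g ∂(nu haarCircle)
      = (∏ i ∈ range j, weightRatio (k + 2 * i) lam)
        * ∫ g, (1 - ‖orbit g‖ ^ 2) ^ (k / 2) * sph lam g ∂(nu haarCircle) :=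
  jacobi_weight_add_two_mul hk h1 h2 j

/-- **ALL NORMALISED MOMENTS OF THE ORBIT RADIUS IN CLOSED FORM**: on the ray,
`E_{k,λ}[|g·0|^{2n}] = ∑_{j ≤ n} (−1)^j C(n, j) ∏_{i<j} r_{k+2i}(λ)`. -/
theorem moment_orbit_sq_eq_sum_prod {k lam : ℝ} (hk : 1 < k) (h1 : lam < k) (h2 : 2 < k + lam)
    (n : ℕ) :
    (∫ g, (‖orbit g‖ ^ 2) ^ n * ((1 - ‖orbit g‖ ^ 2) ^ (k / 2) * sph lam g) ∂(nu haarCircle))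
        / ∫ g, (1 - ‖orbit g‖ ^ 2) ^ (k / 2) * sph lam g ∂(nu haarCircle)
      = ∑ j ∈ range (n + 1), (-1 : ℝ) ^ j * (n.choose j : ℝ)
          * ∏ i ∈ range j, weightRatio (k + 2 * i) lam := by
  have hm : ∫ g, (1 - ‖orbit g‖ ^ 2) ^ (k / 2) * sph lam g ∂(nu haarCircle) ≠ 0 :=
    (jacobi_pos hk h1 h2).ne'
  rw [integral_orbit_pow_mul_eq_sum hk h1 h2 n, Finset.sum_div]
  refine Finset.sum_congr rfl fun j _ => ?_
  rw [jacobi_add_two_mul_eq_prod hk h1 h2 j]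
  field_simp

/-- Every moment of the orbit radius is positive on the ray (the HBW differences are strictly positive
at step `2`). -/
theorem moment_orbit_sq_pos {k lam : ℝ} (hk : 1 < k) (h1 : lam < k) (h2 : 2 < k + lam) (n : ℕ) :
    0 < ∫ g, (‖orbit g‖ ^ 2) ^ n * ((1 - ‖orbit g‖ ^ 2) ^ (k / 2) * sph lam g) ∂(nu haarCircle) := by
  rw [integral_orbit_pow_mul_eq_fwdDiff hk h1 h2 n]
  exact jacobi_fwdDiff_iter_pos hk h1 h2 (by norm_num) n

/-- The second moment in closed form: `E_{k,λ}[|g·0|⁴] = 1 − 2 r_k(λ) + r_k(λ) r_{k+2}(λ)`. -/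
theorem moment_orbit_sq_two {k lam : ℝ} (hk : 1 < k) (h1 : lam < k) (h2 : 2 < k + lam) :
    (∫ g, (‖orbit g‖ ^ 2) ^ 2 * ((1 - ‖orbit g‖ ^ 2) ^ (k / 2) * sph lam g) ∂(nu haarCircle))
        / ∫ g, (1 - ‖orbit g‖ ^ 2) ^ (k / 2) * sph lam g ∂(nu haarCircle)
      = 1 - 2 * weightRatio k lam + weightRatio k lam * weightRatio (k + 2) lam := by
  rw [moment_orbit_sq_eq_sum_prod hk h1 h2 2]
  simp only [Finset.sum_range_succ, Finset.sum_range_zero, Finset.prod_range_succ,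
    Finset.prod_range_zero, Nat.choose_self, Nat.choose_zero_right, Nat.choose_one_right]
  push_cast
  ring_nf

end measure

end Summit.Ventures.HodgeRepro2.T5SU11JacobiOrbitMoments
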